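import Literature.InformationTheory.Coding.SourcePolarizationStepBounds
import Literature.InformationTheory.Coding.SourcePolarizationStepMinus
import Literature.InformationTheory.Coding.SourcePolarizationStepRecursion
import HarnessLib

/-!
# The leakage profile is a leaf profile of the `(minus, plus)`-tree of sources

Theorem-only companion of `Literature/InformationTheory/Coding/SourcePolarizationStep.lean`.
For ANY family of maps `L s : Src → Fin (2^s) → Src` obeying the natural-order tree recursion —
`L 0 S j = S`, `L (s+1) S (loIdx s c) = L s S⁻ c`, `L (s+1) S (hiIdx s c) = L s S⁺ c` (read the bits
of the leaf index from the top; bit `0` applies `Src.minus`, bit `1` applies `Src.plus`) — the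
leakage profile of a packaged source `S` is the profile of conditional entropies of the leaves:
`leak S.g s j = (L s S j).H` (`leak_eq_H_of_leaf`; induction on `s` with `leak_zero`,
`leak_succ_lo`, `leak_succ_hi`).  This is the form in which Arıkan computes the synthetic
conditional entropies `H(U_i | U^{i-1}, Y^N)` recursively through the one-step transforms
[Arıkan 2010, §III; Arıkan 2009, §VII], stated so that any concrete definition of the leaves of a
binary polarization tree (e.g. `PolarTree.leaf Src.minus Src.plus`) plugs in by checking the three
defining equations.

## References

* E. Arıkan, *Source polarization*, Proc. IEEE ISIT 2010, §III.  bib `Arikan2010`.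
* E. Arıkan, *Channel polarization…*, IEEE Trans. IT 55 (2009), §VII.  bib `Arikan2009`.
-/

noncomputable section

namespace Literature.InformationTheory.Coding.Polar

open Finset Literature.InformationTheory.Entropy

/-- **The leakage profile is the leaf profile of the source tree**: if `L` obeys the natural-order
tree recursion (`L 0 S j = S`, low indices go to the subtree of `S⁻`, high indices to the subtree
of `S⁺`), then `leak S.g s j = H(L s S j)` for every packaged source `S`, depth `s` and leaf `j`.
[cite: Arikan2010, §III (H(U_i | U^{i-1}, Y^N) computed recursively through the transforms)] -/
theorem leak_eq_H_of_leaf (L : (s : ℕ) → Src → Fin (2 ^ s) → Src) (h0 : ∀ (S : Src) (j : Fin (2 ^ 0)), L 0 S j = S)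
    (hlo : ∀ (s : ℕ) (S : Src) (c : Fin (2 ^ s)), L (s + 1) S (loIdx s c) = L s S.minus c)
    (hhi : ∀ (s : ℕ) (S : Src) (c : Fin (2 ^ s)), L (s + 1) S (hiIdx s c) = L s S.plus c)
    (S : Src) (s : ℕ) (j : Fin (2 ^ s)) : leak S.g s j = (L s S j).H := by
  induction s generalizing S with
  | zero => rw [leak_zero, h0, Src.H_def]
  | succ s ih =>
    rcases eq_loIdx_or_eq_hiIdx s j with ⟨c, rfl⟩ | ⟨c, rfl⟩
    · rw [leak_succ_lo, ih S.minus c, hlo]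
    · rw [leak_succ_hi, ih S.plus c, hhi]

/-- The same for an unpackaged source `g : ZMod 2 → (Fin m → ZMod 2) → β` (packaged on the fly).
[cite: Arikan2010, §III (H(U_i | U^{i-1}, Y^N) computed recursively through the transforms)] -/
theorem leak_eq_H_of_leaf' (L : (s : ℕ) → Src → Fin (2 ^ s) → Src) (h0 : ∀ (S : Src) (j : Fin (2 ^ 0)), L 0 S j = S)
    (hlo : ∀ (s : ℕ) (S : Src) (c : Fin (2 ^ s)), L (s + 1) S (loIdx s c) = L s S.minus c)
    (hhi : ∀ (s : ℕ) (S : Src) (c : Fin (2 ^ s)), L (s + 1) S (hiIdx s c) = L s S.plus c)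
    {m : ℕ} {β : Type} [DecidableEq β] (g : ZMod 2 → (Fin m → ZMod 2) → β) (s : ℕ) (j : Fin (2 ^ s)) :
    leak g s j = (L s (Src.mk m β g) j).H :=
  leak_eq_H_of_leaf L h0 hlo hhi (Src.mk m β g) s j

/-- **Summary of the one-step relations of binary sources with functional side information**
(uniform source bit), in the order `0 ≤ Z ≤ 1`, `0 ≤ H ≤ 1`, `H⁻ + H⁺ = 2H`, `Z⁺ = Z²`,
`Z⁻ ≤ 2Z − Z²`, `Z√(2−Z²) ≤ Z⁻`, `Z² ≤ H`, `H ≤ log₂(1+Z)` — everything an abstract polarization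
argument over the `(Src.minus, Src.plus)`-tree consumes.
[cite: Arikan2010, Prop. 1–2 (with Arikan2009 Prop. 5 and KoradaUrbanke2010 Lemma 17 for Z⁻)] -/
theorem Src.one_step_relations (S : Src) :
    0 ≤ S.zParam ∧ S.zParam ≤ 1 ∧ 0 ≤ S.H ∧ S.H ≤ 1 ∧ S.minus.H + S.plus.H = 2 * S.H ∧
      S.plus.zParam = S.zParam ^ 2 ∧ S.minus.zParam ≤ 2 * S.zParam - S.zParam ^ 2 ∧
      S.zParam * Real.sqrt (2 - S.zParam ^ 2) ≤ S.minus.zParam ∧ S.zParam ^ 2 ≤ S.H ∧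
      S.H ≤ Real.logb 2 (1 + S.zParam) :=
  ⟨S.zParam_nonneg, S.zParam_le_one, S.H_nonneg, S.H_le_one, S.H_step, S.zParam_plus_eq,
    S.zParam_minus_le, S.zParam_minus_ge, S.sq_zParam_le_H, S.H_le_logb⟩

end Literature.InformationTheory.Coding.Polar

end
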